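import Summits.QuantumFields.YangMills.Theses.ConvexGribovBody
import Summits.QuantumFields.YangMills.Theorems.FradkinShenkerFlowSusceptibilityToPoincareHaarResample
import Summits.QuantumFields.YangMills.Theorems.SusceptibilityToPoincare.Negative.HeatBathExchange
import Literature.MathematicalPhysics.QuantumFieldTheory.UnitaryCayleyChart

/-!
# `PoincareToGap` — negative side: the plaquette has volume-uniform variance under the torus Wilson measure

Negative-side support for crux `stmt-QuantumFields-8781`
(`Summit.QuantumFields.YangMills.Theses.ConvexGribovBody.PoincareToGap`), from the standing
disprover's work file `Cruxes/PoincareToGap/Disproof.lean` §4. The crux concludes the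
`UniformLatticeGap` body at the coupling `β` (`|corr_S(A,B,n)| ≤ C(A,B) e^{-m n}`, `n ≤ S`, on the
tori `(2S+1)⁴`). With the periodicity lemmas of the sibling file `Negative/Tightness.lean`
(`not_clusteringAllSep_of_cov_lower_bound`) the covariance lower bound proved here shows that the
restriction `n ≤ S` cannot be dropped, for every admissible `G`, `r` and EVERY real `β`.

* `haar_variance_re_trace_pos` — the character `Re tr ρ` has positive Haar variance on a
  non-trivial group (`Re tr (1 − V) = ‖1 − V‖²_F / 2` for unitary `V`, faithfulness, and the Haar
  measure charges open sets); `haar_variance_le_integral_sq_sub` — shifting the centre and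
  right-translating the argument only increases the mean square;
* `plaquetteObs_torusLift_update` — on a torus of side `≥ 3`, resampling the first link of the
  `(1,2)`-plaquette at the origin turns it into `Re tr ρ(h · M(U))`;
* `exists_plaquette_variance_lower_bound` — **`Var_{μ_{β,S}}(Re tr ρ(U_p)) ≥ e^{-c|β|} Var_Haar(Re tr ρ) > 0`
  uniformly in `S ≥ 1`**, by the DLR consistency of the one-link heat bath
  (`SusceptibilityToPoincare.Negative.lintegral_heatBath_update`) and the volume-uniform lower
  bound `e^{-c}` on the heat-bath density against Haar
  (`SusceptibilityToPoincare.HaarResample.integral_le_exp_mul_integral_tilted`,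
  `…abs_wilsonAction_update_sub_le`);
* `latticeConnectedCorr_self_zero` — `corr_S(A, A, 0) = Var_{μ_{β,S}}(A)`;
  `exists_cov_lower_bound` — a gauge-invariant local observable with `|corr_S(A,A,0)| ≥ v > 0` on
  every torus `S ≥ 1`.

Every compact `G` with an element `≠ 1`, every real `β`; nothing here asserts a Theses statement.
-/

noncomputable section

namespace Summit.QuantumFields.YangMills.Theorems.PoincareToGap.Negative

open MeasureTheory ProbabilityTheory Filter Topology Function
open scoped ENNReal Matrix.Norms.Frobenius
open Literature.MathematicalPhysics.QuantumFieldTheory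
open Literature.MathematicalPhysics.QuantumLattice (torusLift configShift configShift_apply torusEdge
  LGConfig plaquetteObs plaquetteHolonomyZd)

variable {G : Type} [Group G] [TopologicalSpace G] [IsTopologicalGroup G] [CompactSpace G]
  [MeasurableSpace G] [BorelSpace G]

/-! ### The character `Re tr ρ` has positive Haar variance -/

omit [IsTopologicalGroup G] [CompactSpace G] [MeasurableSpace G] [BorelSpace G] in
/-- `Re tr ρ` is continuous. [folklore] -/
theorem continuous_re_trace (r : LatticeRep G) : Continuous fun g : G => (r.ρ g).trace.re :=
  Complex.continuous_re.comp (Continuous.matrix_trace r.continuous)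

omit [IsTopologicalGroup G] [MeasurableSpace G] [BorelSpace G] in
/-- `Re tr ρ` is bounded on the compact group. [folklore] -/
theorem exists_abs_re_trace_le (r : LatticeRep G) : ∃ C : ℝ, 0 ≤ C ∧ ∀ g : G, |(r.ρ g).trace.re| ≤ C := by
  obtain ⟨C, hC⟩ := (isCompact_univ.image
    (continuous_abs.comp (continuous_re_trace r))).isBounded.bddAbove
  refine ⟨max C 0, le_max_right _ _, fun g => (hC ⟨g, Set.mem_univ _, rfl⟩).trans (le_max_left _ _)⟩

omit [TopologicalSpace G] [IsTopologicalGroup G] [CompactSpace G] [MeasurableSpace G] [BorelSpace G] in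
/-- For a faithful unitary representation, `Re tr ρ(g) < N` away from the identity
(`Re tr (1 - V) = ‖1 - V‖²_F / 2` for unitary `V`). [folklore] -/
theorem re_trace_lt_of_ne_one [TopologicalSpace G] (r : LatticeRep G) {g : G} (hg : g ≠ 1) :
    (r.ρ g).trace.re < r.N := by
  have hne : (1 : Matrix (Fin r.N) (Fin r.N) ℂ) - r.ρ g ≠ 0 := by
    intro h
    apply hg
    apply r.injective
    rw [map_one]
    exact (sub_eq_zero.mp h).symm
  have h := UnitaryCayley.re_trace_one_sub (r.mem_unitary g)
  rw [Matrix.trace_sub, Complex.sub_re, Matrix.trace_one, Fintype.card_fin] at h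
  have hpos : 0 < ‖(1 : Matrix (Fin r.N) (Fin r.N) ℂ) - r.ρ g‖ ^ 2 / 2 := by positivity
  have hN : ((r.N : ℂ)).re = (r.N : ℝ) := by simp
  linarith [hN]

/-- **The character has positive Haar variance** on a non-trivial group: `Re tr ρ` is continuous,
non-constant (`= N` at `1`, `< N` at `g₀ ≠ 1` by faithfulness), and the Haar measure charges
every non-empty open set. [folklore] -/
theorem haar_variance_re_trace_pos (r : LatticeRep G) {g₀ : G} (hg₀ : g₀ ≠ 1) :
    0 < ∫ g, ((r.ρ g).trace.re - ∫ h, (r.ρ h).trace.re ∂haarProbability G) ^ 2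
      ∂haarProbability G := by
  set φ : G → ℝ := fun g => (r.ρ g).trace.re with hφ
  set m : ℝ := ∫ h, φ h ∂haarProbability G with hm
  have hφc : Continuous φ := continuous_re_trace r
  have hc : Continuous fun g => (φ g - m) ^ 2 := (hφc.sub continuous_const).pow 2
  obtain ⟨C, hC0, hC⟩ := exists_abs_re_trace_le r
  have hint : Integrable (fun g => (φ g - m) ^ 2) (haarProbability G) := by
    refine Integrable.of_bound hc.measurable.aestronglyMeasurable ((C + |m|) ^ 2)
      (ae_of_all _ fun g => ?_)
    rw [Real.norm_eq_abs, abs_pow]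
    exact pow_le_pow_left₀ (abs_nonneg _) ((abs_sub _ _).trans (add_le_add (hC g) le_rfl)) 2
  have h0 : 0 ≤ ∫ g, (φ g - m) ^ 2 ∂haarProbability G := integral_nonneg fun g => sq_nonneg _
  rcases h0.lt_or_eq with hlt | heq
  · exact hlt
  exfalso
  have hae : (fun g => (φ g - m) ^ 2) =ᵐ[haarProbability G] 0 :=
    (integral_eq_zero_iff_of_nonneg (fun g => sq_nonneg _) hint).mp heq.symm
  have hae' : φ =ᵐ[haarProbability G] fun _ => m := by
    filter_upwards [hae] with g hg
    have : φ g - m = 0 := pow_eq_zero_iff (n := 2) (by norm_num) |>.mp hg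
    linarith
  have hconst : φ = fun _ => m := Measure.eq_of_ae_eq hae' hφc continuous_const
  have h1 : φ 1 = (r.N : ℝ) := by
    simp [hφ, map_one, Matrix.trace_one]
  have h2 : φ g₀ < r.N := re_trace_lt_of_ne_one r hg₀
  have : φ 1 = φ g₀ := by rw [hconst]
  linarith

/-- Shifting the centre and right-translating the argument can only increase the mean square:
`Var_Haar(Re tr ρ) ≤ ∫ (Re tr ρ(h·M) − a)² dHaar(h)` (right invariance of Haar on the compact
group, and `E(X − a)² = Var X + (EX − a)²`). [folklore] -/
theorem haar_variance_le_integral_sq_sub (r : LatticeRep G) (a : ℝ) (M : G) :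
    ∫ g, ((r.ρ g).trace.re - ∫ h, (r.ρ h).trace.re ∂haarProbability G) ^ 2 ∂haarProbability G ≤
      ∫ h, ((r.ρ (h * M)).trace.re - a) ^ 2 ∂haarProbability G := by
  set φ : G → ℝ := fun g => (r.ρ g).trace.re with hφ
  set m : ℝ := ∫ h, φ h ∂haarProbability G with hm
  have hφc : Continuous φ := continuous_re_trace r
  obtain ⟨C, hC0, hC⟩ := exists_abs_re_trace_le r
  have hφi : Integrable φ (haarProbability G) :=
    Integrable.of_bound hφc.measurable.aestronglyMeasurable C
      (ae_of_all _ fun g => by simpa [Real.norm_eq_abs] using hC g)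
  -- right translation
  have hR : ∫ h, (φ (h * M) - a) ^ 2 ∂haarProbability G = ∫ h, (φ h - a) ^ 2 ∂haarProbability G :=
    integral_mul_right_eq_self (fun h => (φ h - a) ^ 2) M
  change ∫ g, (φ g - m) ^ 2 ∂haarProbability G ≤ ∫ h, (φ (h * M) - a) ^ 2 ∂haarProbability G
  rw [hR]
  -- `(φ - a)² = (φ - m)² + 2 (m - a) (φ - m) + (m - a)²`
  have hsq : ∀ g, (φ g - a) ^ 2 = (φ g - m) ^ 2 + (2 * (m - a) * (φ g - m) + (m - a) ^ 2) :=
    fun g => by ring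
  have hi1 : Integrable (fun g => (φ g - m) ^ 2) (haarProbability G) := by
    refine Integrable.of_bound ((hφc.sub continuous_const).pow 2).measurable.aestronglyMeasurable
      ((C + |m|) ^ 2) (ae_of_all _ fun g => ?_)
    rw [Real.norm_eq_abs, abs_pow]
    exact pow_le_pow_left₀ (abs_nonneg _) ((abs_sub _ _).trans (add_le_add (hC g) le_rfl)) 2
  have hsub : Integrable (fun g => φ g - m) (haarProbability G) := hφi.sub (integrable_const m)
  have hlin : Integrable (fun g => 2 * (m - a) * (φ g - m)) (haarProbability G) :=
    hsub.const_mul (2 * (m - a))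
  have hi2 : Integrable (fun g => 2 * (m - a) * (φ g - m) + (m - a) ^ 2) (haarProbability G) :=
    hlin.add (integrable_const _)
  have hmean : ∫ g, (φ g - m) ∂haarProbability G = 0 := by
    rw [integral_sub hφi (integrable_const m), integral_const]
    simp [hm]
  have hI2 : ∫ g, (2 * (m - a) * (φ g - m) + (m - a) ^ 2) ∂haarProbability G = (m - a) ^ 2 := by
    rw [integral_add hlin (integrable_const _), integral_const_mul, hmean, integral_const]
    simp
  simp_rw [hsq]
  rw [integral_add hi1 hi2, hI2]
  nlinarith [sq_nonneg (m - a)]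


/-! ### The time-zero `(1,2)`-plaquette at the origin of the torus, resampled in its first link -/

open Summit.QuantumFields.YangMills.Theorems.SusceptibilityToPoincare
open Summit.QuantumFields.YangMills.Theorems.SusceptibilityToPoincare.Negative
  (lintegral_heatBath_update isProbabilityMeasure_heatBath)

omit [IsTopologicalGroup G] [CompactSpace G] [MeasurableSpace G] [BorelSpace G] in
/-- **Resampling the first link of the plaquette**: on a torus of side `2S+1 ≥ 3`, replacing the
link `ℓ = (0, 1)` by `h` turns the `(1,2)`-plaquette at the origin into `Re tr ρ(h · M(U))` with
`M(U) = U(e₁,2) U(e₂,1)⁻¹ U(0,2)⁻¹` independent of `h` (the other three edges differ from `ℓ`).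
[folklore] -/
theorem plaquetteObs_torusLift_update (r : LatticeRep G) {S : ℕ} (hS : 1 ≤ S)
    (U : GaugeConfig 4 (2 * S + 1) G) (h : G) :
    plaquetteObs r.ρ 0 1 2 (torusLift (2 * S + 1) (update U
      (torusEdge (2 * S + 1) ((0 : Literature.Probability.LatticeModels.Site 4), (1 : Fin 4))) h)) =
      (r.ρ (h * (U (torusEdge (2 * S + 1) ((0 : Literature.Probability.LatticeModels.Site 4) +
          Pi.single (1 : Fin 4) 1, 2)) *
        (U (torusEdge (2 * S + 1) ((0 : Literature.Probability.LatticeModels.Site 4) +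
          Pi.single (2 : Fin 4) 1, 1)))⁻¹ *
        (U (torusEdge (2 * S + 1) ((0 : Literature.Probability.LatticeModels.Site 4), 2)))⁻¹))).trace.re := by
  haveI : Fact (1 < 2 * S + 1) := ⟨by omega⟩
  have hA : torusEdge (2 * S + 1) ((0 : Literature.Probability.LatticeModels.Site 4) +
      Pi.single (1 : Fin 4) 1, (2 : Fin 4)) ≠ torusEdge (2 * S + 1) ((0 : Literature.Probability.LatticeModels.Site 4), (1 : Fin 4)) := fun e => by
    have := congrArg Prod.snd e
    simp [torusEdge] at this
  have hB : torusEdge (2 * S + 1) ((0 : Literature.Probability.LatticeModels.Site 4) +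
      Pi.single (2 : Fin 4) 1, (1 : Fin 4)) ≠ torusEdge (2 * S + 1) ((0 : Literature.Probability.LatticeModels.Site 4), (1 : Fin 4)) := fun e => by
    have := congrArg (fun e : Edge 4 (2 * S + 1) => e.1 2) e
    simp [torusEdge, Literature.Probability.LatticeModels.Torus.proj_apply] at this
  have hC : torusEdge (2 * S + 1) ((0 : Literature.Probability.LatticeModels.Site 4), (2 : Fin 4)) ≠
      torusEdge (2 * S + 1) ((0 : Literature.Probability.LatticeModels.Site 4), (1 : Fin 4)) := fun e => by
    have := congrArg Prod.snd e
    simp [torusEdge] at this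
  simp only [plaquetteObs, plaquetteHolonomyZd, torusLift, Function.comp_apply,
    update_self, update_of_ne hA, update_of_ne hB, update_of_ne hC, mul_assoc]

/-! ### A volume-uniform lower bound on the variance of the plaquette -/

/-- **Volume-uniform variance lower bound for the plaquette under the torus Wilson measure.**
For every compact `G` with a faithful unitary representation `r`, an element `g₀ ≠ 1` and every
real `β` there is `v = v(G, r, β) > 0` with `Var_{μ_{β,S}}(Re tr ρ(U_p)) ≥ v` for the time-zero
`(1,2)`-plaquette `p` at the origin on EVERY torus `(2S+1)⁴`, `S ≥ 1`. Proof: resample the first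
link of `p` — by DLR consistency of the one-link heat bath (`lintegral_heatBath_update`)
`Var(f) = ∫∫ (f(U[ℓ↦g]) − E f)² dν_ℓ^U(g) dμ(U)`; the heat-bath density against Haar is at least
`e^{−c}`, `c = |β| · (volume-uniform one-link oscillation of the Wilson action)`
(`HaarResample.integral_le_exp_mul_integral_tilted`, `HaarResample.abs_wilsonAction_update_sub_le`);
and against Haar the inner integral is `∫ (Re tr ρ(h M(U)) − E f)² dh ≥ Var_Haar(Re tr ρ) > 0`
(`plaquetteObs_torusLift_update`, right invariance, `haar_variance_re_trace_pos`). [folklore] -/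
theorem exists_plaquette_variance_lower_bound (r : LatticeRep G) {g₀ : G} (hg₀ : g₀ ≠ 1) (β : ℝ) :
    ∃ v : ℝ, 0 < v ∧ ∀ S : ℕ, 1 ≤ S →
      v ≤ ∫ U, (plaquetteObs r.ρ 0 1 2 (torusLift (2 * S + 1) U) -
          ∫ V, plaquetteObs r.ρ 0 1 2 (torusLift (2 * S + 1) V)
            ∂(wilsonMeasure (d := 4) (L := 2 * S + 1) r.ρ β)) ^ 2
        ∂(wilsonMeasure (d := 4) (L := 2 * S + 1) r.ρ β) := by
  haveI : SecondCountableTopology G :=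
    (r.continuous.isClosedEmbedding r.injective).isEmbedding.secondCountableTopology
  -- constants: the Haar variance `v₀ > 0`, the trace bound `Mt`, the oscillation constant `c`
  set v₀ : ℝ := ∫ g, ((r.ρ g).trace.re - ∫ h, (r.ρ h).trace.re ∂haarProbability G) ^ 2
    ∂haarProbability G with hv₀
  have hv₀pos : 0 < v₀ := haar_variance_re_trace_pos r hg₀
  obtain ⟨Mt, hMt0, hMt⟩ := exists_abs_re_trace_le r
  set c : ℝ := |β| * (2 * ((((4 + 1) * Fintype.card {q : Fin 4 × Fin 4 // q.1 < q.2} : ℕ) : ℝ) *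
    ((r.N : ℝ) + Mt))) with hc
  refine ⟨Real.exp (-c) * v₀, mul_pos (Real.exp_pos _) hv₀pos, fun S hS => ?_⟩
  -- notation for the torus of side `2S+1`
  set μ : Measure (GaugeConfig 4 (2 * S + 1) G) := wilsonMeasure (d := 4) (L := 2 * S + 1) r.ρ β
    with hμ
  haveI : IsProbabilityMeasure μ := isProbabilityMeasure_wilsonMeasure _ r.continuous β
  set f : GaugeConfig 4 (2 * S + 1) G → ℝ := fun U => plaquetteObs r.ρ 0 1 2 (torusLift (2 * S + 1) U)
    with hf
  set m : ℝ := ∫ V, f V ∂μ with hm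
  set ℓ : Edge 4 (2 * S + 1) :=
    torusEdge (2 * S + 1) ((0 : Literature.Probability.LatticeModels.Site 4), (1 : Fin 4)) with hℓ
  change Real.exp (-c) * v₀ ≤ ∫ U, (f U - m) ^ 2 ∂μ
  -- measurability and bounds for `f`
  have hfm : Measurable f :=
    (Literature.MathematicalPhysics.QuantumLattice.measurable_plaquetteObs r.ρ r.continuous 0 1 2).comp
      (measurable_torusLift (2 * S + 1))
  obtain ⟨Cf, hCf⟩ : ∃ C, ∀ U, |f U| ≤ C :=
    let ⟨C, hC⟩ := Literature.MathematicalPhysics.QuantumLattice.exists_abs_plaquetteObs_le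
      r.ρ r.continuous 0 1 2
    ⟨C, fun U => hC _⟩
  set ψ : GaugeConfig 4 (2 * S + 1) G → ℝ := fun V => (f V - m) ^ 2 with hψ
  have hψm : Measurable ψ := (hfm.sub measurable_const).pow_const 2
  have hψ0 : ∀ V, 0 ≤ ψ V := fun V => sq_nonneg _
  have hψB : ∀ V, ψ V ≤ (Cf + |m|) ^ 2 := fun V => by
    have h1 : |f V - m| ≤ Cf + |m| := (abs_sub _ _).trans (add_le_add (hCf V) le_rfl)
    calc ψ V = |f V - m| ^ 2 := (sq_abs _).symm
      _ ≤ (Cf + |m|) ^ 2 := pow_le_pow_left₀ (abs_nonneg _) h1 2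
  -- the tilt of the heat bath at `ℓ` and its volume-uniform oscillation
  set tilt : GaugeConfig 4 (2 * S + 1) G → G → ℝ := fun U g' =>
    -β * wilsonAction r.ρ (update U ℓ g') with htilt
  have htm : ∀ U, Measurable (tilt U) := fun U =>
    measurable_const.mul ((measurable_wilsonAction r.ρ r.continuous).comp (measurable_update U))
  obtain ⟨A, hA⟩ := exists_abs_wilsonAction_le (d := 4) (L := 2 * S + 1) (G := G) r.ρ r.continuous
  have hti : ∀ U, Integrable (fun g => Real.exp (tilt U g)) (haarProbability G) := fun U => by
    refine Integrable.of_bound (Real.measurable_exp.comp (htm U)).aestronglyMeasurable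
      (Real.exp (|β| * A)) (ae_of_all _ fun g => ?_)
    rw [Real.norm_eq_abs, Real.abs_exp]
    refine Real.exp_le_exp.2 ?_
    calc -β * wilsonAction r.ρ (update U ℓ g)
        ≤ |-β * wilsonAction r.ρ (update U ℓ g)| := le_abs_self _
      _ = |β| * |wilsonAction r.ρ (update U ℓ g)| := by rw [abs_mul, abs_neg]
      _ ≤ |β| * A := mul_le_mul_of_nonneg_left (hA _) (abs_nonneg β)
  have hosc : ∀ (U : GaugeConfig 4 (2 * S + 1) G) (h h' : G), tilt U h' ≤ tilt U h + c :=
    fun U h h' => by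
    have hd := HaarResample.abs_wilsonAction_update_sub_le r.ρ hMt0 hMt U ℓ h h'
    have h2 : β * (wilsonAction r.ρ (update U ℓ h) - wilsonAction r.ρ (update U ℓ h')) ≤ c :=
      calc _ ≤ |β * (wilsonAction r.ρ (update U ℓ h) - wilsonAction r.ρ (update U ℓ h'))| :=
            le_abs_self _
        _ = |β| * |wilsonAction r.ρ (update U ℓ h) - wilsonAction r.ρ (update U ℓ h')| :=
            abs_mul _ _
        _ ≤ c := mul_le_mul_of_nonneg_left hd (abs_nonneg β)
    simp only [htilt]
    linarith
  -- pointwise in `U`: `e^{-c} v₀ ≤ ∫ ψ(U[ℓ ↦ g]) dν_ℓ^U(g)`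
  have hpt : ∀ U : GaugeConfig 4 (2 * S + 1) G, Real.exp (-c) * v₀ ≤
      ∫ g, ψ (update U ℓ g) ∂((haarProbability G).tilted (tilt U)) := fun U => by
    -- against Haar: `v₀ ≤ ∫ ψ(U[ℓ ↦ h]) dHaar(h)`
    have hHaar : v₀ ≤ ∫ h, ψ (update U ℓ h) ∂haarProbability G := by
      have := haar_variance_le_integral_sq_sub r m
        (U (torusEdge (2 * S + 1) ((0 : Literature.Probability.LatticeModels.Site 4) +
            Pi.single (1 : Fin 4) 1, 2)) *
          (U (torusEdge (2 * S + 1) ((0 : Literature.Probability.LatticeModels.Site 4) +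
            Pi.single (2 : Fin 4) 1, 1)))⁻¹ *
          (U (torusEdge (2 * S + 1) ((0 : Literature.Probability.LatticeModels.Site 4), 2)))⁻¹)
      refine this.trans_eq (integral_congr_ae (ae_of_all _ fun h => ?_))
      simp only [hψ, hf, hℓ, plaquetteObs_torusLift_update r hS U h]
    -- Haar ≤ e^{c} · heat bath
    have hdom := HaarResample.integral_le_exp_mul_integral_tilted (κ := haarProbability G)
      (ψ := fun h => ψ (update U ℓ h)) (B := (Cf + |m|) ^ 2)
      (htm U) (hti U) (hosc U) (hψm.comp (measurable_update U)) (fun h => hψ0 _)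
      (fun h => hψB _)
    have hexp : Real.exp (-c) * Real.exp c = 1 := by rw [← Real.exp_add, neg_add_cancel, Real.exp_zero]
    calc Real.exp (-c) * v₀ ≤ Real.exp (-c) * ∫ h, ψ (update U ℓ h) ∂haarProbability G :=
          mul_le_mul_of_nonneg_left hHaar (Real.exp_pos _).le
      _ ≤ Real.exp (-c) * (Real.exp c * ∫ g, ψ (update U ℓ g) ∂((haarProbability G).tilted (tilt U))) :=
          mul_le_mul_of_nonneg_left hdom (Real.exp_pos _).le
      _ = _ := by rw [← mul_assoc, hexp, one_mul]
  -- integrate in `U` with the DLR identity of the heat bath (extended non-negative form)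
  have hDLR := lintegral_heatBath_update r β S ℓ (ψ := fun V => ENNReal.ofReal (ψ V))
    hψm.ennreal_ofReal
  have hψi : Integrable ψ μ := Integrable.of_bound hψm.aestronglyMeasurable ((Cf + |m|) ^ 2)
    (ae_of_all _ fun V => by rw [Real.norm_eq_abs, abs_of_nonneg (hψ0 V)]; exact hψB V)
  have hVar : ENNReal.ofReal (∫ U, ψ U ∂μ) = ∫⁻ U, ENNReal.ofReal (ψ U) ∂μ :=
    ofReal_integral_eq_lintegral_ofReal hψi (ae_of_all _ hψ0)
  have hinner : ∀ U : GaugeConfig 4 (2 * S + 1) G,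
      ∫⁻ g, ENNReal.ofReal (ψ (update U ℓ g)) ∂((haarProbability G).tilted (tilt U)) =
        ENNReal.ofReal (∫ g, ψ (update U ℓ g) ∂((haarProbability G).tilted (tilt U))) := fun U => by
    haveI := isProbabilityMeasure_heatBath r β S ℓ U
    refine (ofReal_integral_eq_lintegral_ofReal ?_ (ae_of_all _ fun g => hψ0 _)).symm
    exact Integrable.of_bound (hψm.comp (measurable_update U)).aestronglyMeasurable ((Cf + |m|) ^ 2)
      (ae_of_all _ fun g => by rw [Real.norm_eq_abs, abs_of_nonneg (hψ0 _)]; exact hψB _)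
  have hkey : ENNReal.ofReal (Real.exp (-c) * v₀) ≤ ENNReal.ofReal (∫ U, ψ U ∂μ) := by
    rw [hVar, ← hDLR]
    calc ENNReal.ofReal (Real.exp (-c) * v₀) = ∫⁻ _U, ENNReal.ofReal (Real.exp (-c) * v₀) ∂μ := by
          rw [lintegral_const, measure_univ, mul_one]
      _ ≤ _ := lintegral_mono fun U => by
          rw [hinner U]
          exact ENNReal.ofReal_le_ofReal (hpt U)
  exact (ENNReal.ofReal_le_ofReal_iff (integral_nonneg hψ0)).mp hkey


/-! ### The equal-time covariance `corr_S(A, A, 0)` is the variance -/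

/-- At separation `n = 0` the torus time-correlation of `A` with itself is its variance under
the torus Wilson measure (the time shift by `0` is the identity). [folklore] -/
theorem latticeConnectedCorr_self_zero (r : LatticeRep G) (β : ℝ) (S : ℕ) (A : YMSpecies G) :
    latticeConnectedCorr r.ρ β (2 * S + 1) A.F A.F 0 =
      ∫ U, (A.F (torusLift (2 * S + 1) U) -
          ∫ V, A.F (torusLift (2 * S + 1) V) ∂(wilsonMeasure (d := 4) (L := 2 * S + 1) r.ρ β)) ^ 2
        ∂(wilsonMeasure (d := 4) (L := 2 * S + 1) r.ρ β) := by
  set μ : Measure (GaugeConfig 4 (2 * S + 1) G) := wilsonMeasure (d := 4) (L := 2 * S + 1) r.ρ β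
    with hμ
  haveI : IsProbabilityMeasure μ := isProbabilityMeasure_wilsonMeasure _ r.continuous β
  set g : GaugeConfig 4 (2 * S + 1) G → ℝ := fun U => A.F (torusLift (2 * S + 1) U) with hg
  have h0 : ∀ W : LGConfig 4 G,
      configShift (-Pi.single (0 : Fin 4) ((0 : ℕ) : ℤ)) W = W := fun W => by
    funext e
    simp [configShift_apply]
  have hgm : Measurable g := A.measurable.comp (measurable_torusLift (2 * S + 1))
  obtain ⟨C, hC⟩ := A.bounded
  have hgb : ∀ U, |g U| ≤ C := fun U => hC _
  have hgi : Integrable g μ :=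
    Integrable.of_bound hgm.aestronglyMeasurable C (ae_of_all _ fun U => by
      simpa [Real.norm_eq_abs] using hgb U)
  have hC0 : 0 ≤ C := (abs_nonneg _).trans (hgb fun _ => 1)
  have hggi : Integrable (fun U => g U * g U) μ := by
    refine Integrable.of_bound (hgm.mul hgm).aestronglyMeasurable (C * C) (ae_of_all _ fun U => ?_)
    rw [Real.norm_eq_abs, abs_mul]
    exact mul_le_mul (hgb U) (hgb U) (abs_nonneg _) hC0
  set m : ℝ := ∫ V, g V ∂μ with hm
  have hlhs : latticeConnectedCorr r.ρ β (2 * S + 1) A.F A.F 0 = ∫ U, g U * g U ∂μ - m * m := by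
    simp only [latticeConnectedCorr, h0, hg, hm, hμ]
  rw [hlhs]
  change ∫ U, g U * g U ∂μ - m * m = ∫ U, (g U - m) ^ 2 ∂μ
  have hsq : ∀ U, (g U - m) ^ 2 = g U * g U + ((-(2 * m)) * g U + m ^ 2) := fun U => by ring
  have hi2 : Integrable (fun U => (-(2 * m)) * g U + m ^ 2) μ :=
    (hgi.const_mul _).add (integrable_const _)
  simp_rw [hsq]
  rw [integral_add hggi hi2, integral_add (hgi.const_mul _) (integrable_const _), integral_const_mul,
    integral_const]
  simp only [probReal_univ, one_smul]
  ring

/-- **The plaquette has equal-time torus covariance bounded below along all tori.** For every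
compact `G` with an element `g₀ ≠ 1`, every faithful unitary `r` and every real `β` there are a
gauge-invariant local observable `A` (the `(1,2)`-plaquette at the origin) and `v > 0` with
`corr_S(A, A, 0) = Var_{μ_{β,S}}(A) ≥ v` on every torus `(2S+1)⁴`, `S ≥ 1`. [folklore] -/
theorem exists_cov_lower_bound (r : LatticeRep G) {g₀ : G} (hg₀ : g₀ ≠ 1) (β : ℝ) :
    ∃ A : YMSpecies G, ∃ v : ℝ, 0 < v ∧ ∀ S : ℕ, 1 ≤ S →
      v ≤ |latticeConnectedCorr r.ρ β (2 * S + 1) A.F A.F 0| := by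
  haveI : SecondCountableTopology G :=
    (r.continuous.isClosedEmbedding r.injective).isEmbedding.secondCountableTopology
  obtain ⟨v, hv, h⟩ := exists_plaquette_variance_lower_bound r hg₀ β
  refine ⟨Literature.MathematicalPhysics.QuantumLattice.plaquetteObservable r.ρ r.continuous 1 2, v, hv,
    fun S hS => ?_⟩
  rw [latticeConnectedCorr_self_zero,
    Literature.MathematicalPhysics.QuantumLattice.plaquetteObservable_F]
  exact (h S hS).trans (le_abs_self _)


end Summit.QuantumFields.YangMills.Theorems.PoincareToGap.Negative

end
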